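import Mathlib
import Summits.Ventures.PercRepro2.Sep2OShieldFM
import Summits.Ventures.PercRepro2.A3CutReductionA3

/-!
# The crux is (MEANS-a₃) off the pendant parts plus the UU inequality
(blind cell PercRepro2, night-1 g33; proofs/NIGHT1-G33.md §10; census: UU 2202/2202 on n = 7–10, job j333845)

`UUIneq p ends o a₁ a₂ x` is the centring inequality `D_o · P(Q) ≤ P(Q, o ∈ U) · D` — the positive
association of `U_o` and `U_x` on `Q = {a₁ ↮ a₂}`, equivalently `γ ≤ γ₀`.  By the decomposition
`FMfun = btw + (γ₀ − γ) BR`, `BR ≥ 0` (FMDecomp; the form with `P(Q) ≠ 0` only in Sep2OShieldFM), (FM)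
follows from (MEANS-a₃) and `UUIneq` with no side condition (`FM_of_A3Between_of_UU_all`).  Hence the
night-1 g32 reduction `HCov_all_of_a3BetweenFM_notBehindCut` becomes **`HCov_all_of_a3Between_UU`**:
(HCOV) for all graphs follows from (MEANS-a₃) at every `a₃` not behind a cut vertex
(`A3BetweenNotBehindCut_all`) together with the UU inequality everywhere (`UU_all`).  Standard axioms.
-/

namespace Summit.Ventures.PercRepro2

open UnionCluster CovForm

namespace CovForm

namespace A3Fibre

namespace FMDecomp

section All

variable {V : Type*} {E : Type*} [Fintype V] [DecidableEq V] [Fintype E] [DecidableEq E]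
  {R : Type*} [Field R] [LinearOrder R] [IsStrictOrderedRing R] {ends : E → Sym2 V} {p : E → R}
  {o a₁ a₂ x b : V}

/-- **(FM) from (MEANS-a₃) and the UU inequality, with no side condition.** -/
theorem FM_of_A3Between_of_UU_all (hp : IsProbVec p) (hA : A3Between p ends o a₁ a₂ x b)
    (hUU : Do p ends o a₁ a₂ x * prob p (avoidAll ends a₂ {a₁}) ≤
      LeafStep.mU p ends a₁ a₂ o * prob p (PDEvent ends a₁ a₂ x)) : FM p ends o a₁ a₂ x b := by
  by_cases hQ : prob p (avoidAll ends a₂ {a₁}) = 0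
  · unfold FM
    rw [CutOBehind.FMfun_eq_zero_of_Q_eq_zero' hp o x b hQ]
  by_cases hD : prob p (PDEvent ends a₁ a₂ x) = 0
  · unfold FM
    rw [Sep2Shield.FMfun_eq_btw_add_of_Q hp hQ]
    have hγ : gamma p ends o a₁ a₂ x = 0 := by
      unfold gamma
      rw [hD, div_zero]
    have hγ0 : 0 ≤ gamma0 p ends o a₁ a₂ := by
      unfold gamma0 LeafStep.mU
      exact div_nonneg (add_nonneg (prob_nonneg hp _) (prob_nonneg hp _)) (prob_nonneg hp _)
    rw [hγ, sub_zero]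
    exact add_nonneg hA (mul_nonneg hγ0 (BR_nonneg hp hQ))
  · exact FM_of_A3Between_of_UU hp hD hA hUU

end All

section Closure

variable (R : Type*) [Field R] [LinearOrder R] [IsStrictOrderedRing R]

/-- **The UU inequality** at the mark `o` and the explored vertex `x`: `D_o · P(Q) ≤ P(Q, o ∈ U) · D`,
the positive association of `U_o` and `U_x` on `Q` (equivalently `γ ≤ γ₀`). -/
def UUIneq {V E : Type} [Fintype V] [DecidableEq V] [Fintype E] [DecidableEq E] (p : E → R)
    (ends : E → Sym2 V) (o a₁ a₂ x : V) : Prop :=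
  Do p ends o a₁ a₂ x * prob p (avoidAll ends a₂ {a₁}) ≤
    LeafStep.mU p ends a₁ a₂ o * prob p (PDEvent ends a₁ a₂ x)

/-- **The UU inequality for every finite graph, every mark and every explored vertex.** -/
def UU_all : Prop :=
  ∀ (V E : Type) [Fintype V] [DecidableEq V] [Fintype E] [DecidableEq E]
    (ends : E → Sym2 V) (p : E → R), IsProbVec p → ∀ o a₁ a₂ x : V, UUIneq R p ends o a₁ a₂ x

/-- **(MEANS-a₃) for every finite graph at every `a₃` that is not behind a cut vertex.** -/
def A3BetweenNotBehindCut_all : Prop :=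
  ∀ (V E : Type) [Fintype V] [DecidableEq V] [Fintype E] [DecidableEq E]
    (ends : E → Sym2 V) (p : E → R), IsProbVec p →
    ∀ o a₁ a₂ a₃ b : V, a₁ ≠ a₂ → a₁ ≠ a₃ → a₂ ≠ a₃ → o ≠ a₁ → o ≠ a₂ → o ≠ a₃ → o ≠ b →
      b ≠ a₁ → b ≠ a₂ → b ≠ a₃ → ¬ BehindCut ends o a₁ a₂ a₃ b → A3Between p ends o a₁ a₂ a₃ b

/-- (MEANS-a₃) ∧ (FM) off the pendant parts from (MEANS-a₃) off the pendant parts and UU. -/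
theorem A3BetweenFMNotBehindCut_all_of_UU (hA : A3BetweenNotBehindCut_all R) (hUU : UU_all R) :
    A3BetweenFMNotBehindCut_all R := by
  intro V E _ _ _ _ ends p hp o a₁ a₂ a₃ b h12 h13 h23 ho1 ho2 ho3 hob hb1 hb2 hb3 hB
  have hA' := hA V E ends p hp o a₁ a₂ a₃ b h12 h13 h23 ho1 ho2 ho3 hob hb1 hb2 hb3 hB
  exact ⟨hA', FM_of_A3Between_of_UU_all hp hA' (hUU V E ends p hp o a₁ a₂ a₃)⟩

/-- **(HCOV) for all graphs from (MEANS-a₃) off the pendant parts and the UU inequality.** -/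
theorem HCov_all_of_a3Between_UU (hA : A3BetweenNotBehindCut_all R) (hUU : UU_all R) : HCov_all R :=
  HCov_all_of_a3BetweenFM_notBehindCut R (A3BetweenFMNotBehindCut_all_of_UU R hA hUU)

end Closure

end FMDecomp

end A3Fibre

end CovForm

end Summit.Ventures.PercRepro2
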